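import Summits.NavierStokesRegularity.NavierStokesRegularity.Theorems.CircuitPump.Negative.CriticalBoundRoundOne

/-!
# `CircuitPump` (stmt-NavierStokesRegularity-1834): Type I self-improves to critical boundedness

Negative-side a-priori theorem for the crux `PerpetualPump.CircuitPump` (cdisprove seat, work file
`Cruxes/CircuitPump/Disproof.lean` §(e1)), part 2 of 2: for every solution of a viscous Tao circuit on `(-∞,0)`
(any number of modes `m`, any real structure constants) obeying the Type-I bound
`lam^{3n/5}|X_{i,n}(t)| ≤ C/√(-t)`, the SCALE-CRITICAL amplitude is bounded:
`sup_{i,n,t<0} lam^{n/5}|X_{i,n}(t)| < ∞` (`typeI_critical_bound`; PDE dictionary: a Type-I ancient solution is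
bounded in `Ḃ^{-1}_{∞,∞}` — the `1/|x|` bound on top of `1/√(-t)`). Consequently every crux witness has finite
residues `X_{i,n}(0⁻)` and a frozen `1/|x|`-type trail. Round 2 of the bootstrap: the round-1 bound transported to
the neighbouring scales (`neighbour_abs_le`) makes the right-hand side `O(1 + s^{-1/4} + s^{-1/2})` in the last
dissipative time unit (`abs_rhsF_le_two`, `abs_rhsF_fence_form`), which FENCE 2 integrates down to `t = 0`.
No self-similarity is used. Sorry-free.
-/

set_option linter.dupNamespace false

noncomputable section

open scoped BigOperators
open Real Set

namespace Summit.NavierStokesRegularity.NavierStokesRegularity.Theorems.CircuitPumpNegative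

variable {m : ℕ}

/-! ## Round 2: the improved input bound makes the right-hand side integrable down to `t = 0` -/

/-- Total absolute structure constant (uniform in the output mode). -/
def coeffTot (coeff : Fin m → Fin m → Fin m → Option (Fin 3) → ℝ) : ℝ := ∑ i : Fin m, coeffSum coeff i

/-- `coeffSum i ≤ coeffTot`. -/
theorem coeffSum_le_coeffTot (coeff : Fin m → Fin m → Fin m → Option (Fin 3) → ℝ) (i : Fin m) :
    coeffSum coeff i ≤ coeffTot coeff := by
  unfold coeffTot
  exact Finset.single_le_sum (fun j _ => coeffSum_nonneg coeff j) (Finset.mem_univ i)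

/-- `coeffTot` is nonnegative. -/
theorem coeffTot_nonneg (coeff : Fin m → Fin m → Fin m → Option (Fin 3) → ℝ) : 0 ≤ coeffTot coeff := by
  unfold coeffTot; exact Finset.sum_nonneg fun j _ => coeffSum_nonneg coeff j

/-- Round-1 bound transported to a neighbouring scale `n + o`, `o ≥ -1`, in the clock of scale `n`:
`|X_{j,n+o}(τ)| ≤ lam^{-n/5}·lam^{1/5}·V(s)`, `V(s) = 3C + 4K_tot lam^{1/5} s^{-1/4}`, `s = lam^{4n/5}(-τ)`. -/
theorem neighbour_abs_le {lam : ℝ} (hlam : 1 < lam) (coeff : Fin m → Fin m → Fin m → Option (Fin 3) → ℝ)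
    {X : Fin m → ℤ → ℝ → ℝ} (hode : SolvesODE lam coeff X) {C : ℝ}
    (hTI : ∀ (i : Fin m) (n : ℤ) (t : ℝ), t < 0 → lam ^ ((3 / 5 : ℝ) * n) * |X i n t| ≤ C / Real.sqrt (-t))
    (j : Fin m) (n o : ℤ) (ho : -1 ≤ o) (τ : ℝ) (hτ : τ < 0) :
    |X j (n + o) τ| ≤ lam ^ (-((1 / 5 : ℝ) * n)) * (lam ^ (1 / 5 : ℝ) *
      (3 * C + 4 * (coeffTot coeff * C ^ 2 * lam ^ (1 / 5 : ℝ)) * lam ^ (1 / 5 : ℝ) *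
        (lam ^ ((4 / 5 : ℝ) * n) * (-τ)) ^ (-(1 / 4 : ℝ)))) := by
  have hpos : 0 < lam := by linarith
  have hnτ : 0 < -τ := by linarith
  have hC : 0 ≤ C := typeI_const_nonneg hlam hTI j
  have h1 := round_one hlam coeff hode hTI j (n + o) τ hτ
  have hapos : 0 < lam ^ ((4 / 5 : ℝ) * n) := Real.rpow_pos_of_pos hpos _
  have hs4 : 0 ≤ (lam ^ ((4 / 5 : ℝ) * n) * (-τ)) ^ (-(1 / 4 : ℝ)) := Real.rpow_nonneg (by positivity) _
  -- the neighbour's own clock versus ours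
  have hclock : (lam ^ ((4 / 5 : ℝ) * ((n + o : ℤ) : ℝ)) * (-τ)) ^ (-(1 / 4 : ℝ)) =
      lam ^ (-((1 / 5 : ℝ) * o)) * (lam ^ ((4 / 5 : ℝ) * n) * (-τ)) ^ (-(1 / 4 : ℝ)) := by
    have : lam ^ ((4 / 5 : ℝ) * ((n + o : ℤ) : ℝ)) = lam ^ ((4 / 5 : ℝ) * o) * lam ^ ((4 / 5 : ℝ) * n) := by
      rw [← Real.rpow_add hpos]; congr 1; push_cast; ring
    rw [this, mul_assoc, Real.mul_rpow (Real.rpow_nonneg hpos.le _) (by positivity),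
      ← Real.rpow_mul hpos.le]
    congr 2; ring
  have ho' : lam ^ (-((1 / 5 : ℝ) * o)) ≤ lam ^ (1 / 5 : ℝ) := by
    apply Real.rpow_le_rpow_of_exponent_le hlam.le
    have : (-1 : ℝ) ≤ o := by exact_mod_cast ho
    linarith
  have hKj : coeffSum coeff j * C ^ 2 * lam ^ (1 / 5 : ℝ) ≤ coeffTot coeff * C ^ 2 * lam ^ (1 / 5 : ℝ) := by
    have := coeffSum_le_coeffTot coeff j
    have h2 : 0 ≤ C ^ 2 * lam ^ (1 / 5 : ℝ) := by positivity
    nlinarith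
  -- round 1 for the neighbour, rewritten in our clock and with the total constant
  have h2 : lam ^ ((1 / 5 : ℝ) * ((n + o : ℤ) : ℝ)) * |X j (n + o) τ| ≤
      3 * C + 4 * (coeffTot coeff * C ^ 2 * lam ^ (1 / 5 : ℝ)) * lam ^ (1 / 5 : ℝ) *
        (lam ^ ((4 / 5 : ℝ) * n) * (-τ)) ^ (-(1 / 4 : ℝ)) := by
    rw [hclock] at h1
    refine h1.trans ?_
    have hKt : 0 ≤ coeffTot coeff * C ^ 2 * lam ^ (1 / 5 : ℝ) := by
      have := coeffTot_nonneg coeff; positivity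
    have hA : 4 * (coeffSum coeff j * C ^ 2 * lam ^ (1 / 5 : ℝ)) *
        (lam ^ (-((1 / 5 : ℝ) * o)) * (lam ^ ((4 / 5 : ℝ) * n) * (-τ)) ^ (-(1 / 4 : ℝ))) ≤
        4 * (coeffTot coeff * C ^ 2 * lam ^ (1 / 5 : ℝ)) *
        (lam ^ (1 / 5 : ℝ) * (lam ^ ((4 / 5 : ℝ) * n) * (-τ)) ^ (-(1 / 4 : ℝ))) := by
      apply mul_le_mul _ (mul_le_mul_of_nonneg_right ho' hs4) (by positivity) (by positivity)
      have := coeffSum_nonneg coeff j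
      nlinarith
    linarith
  -- divide by the weight of scale n + o and compare weights
  have hwpos : 0 < lam ^ ((1 / 5 : ℝ) * ((n + o : ℤ) : ℝ)) := Real.rpow_pos_of_pos hpos _
  have hV : 0 ≤ 3 * C + 4 * (coeffTot coeff * C ^ 2 * lam ^ (1 / 5 : ℝ)) * lam ^ (1 / 5 : ℝ) *
      (lam ^ ((4 / 5 : ℝ) * n) * (-τ)) ^ (-(1 / 4 : ℝ)) := by
    have := coeffTot_nonneg coeff; positivity
  have h3 : |X j (n + o) τ| ≤ (lam ^ ((1 / 5 : ℝ) * ((n + o : ℤ) : ℝ)))⁻¹ *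
      (3 * C + 4 * (coeffTot coeff * C ^ 2 * lam ^ (1 / 5 : ℝ)) * lam ^ (1 / 5 : ℝ) *
        (lam ^ ((4 / 5 : ℝ) * n) * (-τ)) ^ (-(1 / 4 : ℝ))) := by
    rw [mul_comm] at h2
    rw [← div_eq_inv_mul]
    exact (le_div_iff₀ hwpos).2 h2
  rw [← mul_assoc]
  refine h3.trans (mul_le_mul_of_nonneg_right ?_ hV)
  rw [← Real.rpow_neg hpos.le]
  have : lam ^ (-((1 / 5 : ℝ) * ((n + o : ℤ) : ℝ))) = lam ^ (-((1 / 5 : ℝ) * n)) * lam ^ (-((1 / 5 : ℝ) * o)) := by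
    rw [← Real.rpow_add hpos]; congr 1; push_cast; ring
  rw [this]
  exact mul_le_mul_of_nonneg_left ho' (Real.rpow_nonneg hpos.le _)

/-- ROUND-2 BOUND ON THE RIGHT-HAND SIDE: with `U(s) = lam^{1/5}(3C + 4K_tot lam^{1/5} s^{-1/4})`,
`|F_{i,n}(τ)| ≤ lam^{3n/5}·(U(s) + S_tot U(s)²)`. -/
theorem abs_rhsF_le_two {lam : ℝ} (hlam : 1 < lam) (coeff : Fin m → Fin m → Fin m → Option (Fin 3) → ℝ)
    {X : Fin m → ℤ → ℝ → ℝ} (hode : SolvesODE lam coeff X) {C : ℝ}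
    (hTI : ∀ (i : Fin m) (n : ℤ) (t : ℝ), t < 0 → lam ^ ((3 / 5 : ℝ) * n) * |X i n t| ≤ C / Real.sqrt (-t))
    (i : Fin m) (n : ℤ) (τ : ℝ) (hτ : τ < 0) :
    |rhsF lam coeff X i n τ| ≤ lam ^ ((3 / 5 : ℝ) * n) *
      ((lam ^ (1 / 5 : ℝ) * (3 * C + 4 * (coeffTot coeff * C ^ 2 * lam ^ (1 / 5 : ℝ)) * lam ^ (1 / 5 : ℝ) *
          (lam ^ ((4 / 5 : ℝ) * n) * (-τ)) ^ (-(1 / 4 : ℝ)))) +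
        coeffTot coeff *
          (lam ^ (1 / 5 : ℝ) * (3 * C + 4 * (coeffTot coeff * C ^ 2 * lam ^ (1 / 5 : ℝ)) * lam ^ (1 / 5 : ℝ) *
            (lam ^ ((4 / 5 : ℝ) * n) * (-τ)) ^ (-(1 / 4 : ℝ)))) ^ 2) := by
  have hpos : 0 < lam := by linarith
  have hnτ : 0 < -τ := by linarith
  have hC : 0 ≤ C := typeI_const_nonneg hlam hTI i
  -- abbreviations
  obtain ⟨U, hU, hUnn⟩ : ∃ U : ℝ, U = lam ^ (1 / 5 : ℝ) *
      (3 * C + 4 * (coeffTot coeff * C ^ 2 * lam ^ (1 / 5 : ℝ)) * lam ^ (1 / 5 : ℝ) *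
        (lam ^ ((4 / 5 : ℝ) * n) * (-τ)) ^ (-(1 / 4 : ℝ))) ∧ 0 ≤ U :=
    ⟨_, rfl, by
      have := coeffTot_nonneg coeff
      have : 0 ≤ (lam ^ ((4 / 5 : ℝ) * n) * (-τ)) ^ (-(1 / 4 : ℝ)) := Real.rpow_nonneg (by positivity) _
      positivity⟩
  obtain ⟨w3, hw3, hw3pos⟩ : ∃ w3 : ℝ, w3 = lam ^ ((3 / 5 : ℝ) * n) ∧ 0 < w3 :=
    ⟨_, rfl, Real.rpow_pos_of_pos hpos _⟩
  rw [← hU, ← hw3]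
  have hnb : ∀ (j : Fin m) (o : ℤ), -1 ≤ o → |X j (n + o) τ| ≤ lam ^ (-((1 / 5 : ℝ) * n)) * U := by
    intro j o ho
    have := neighbour_abs_le hlam coeff hode hTI j n o ho τ hτ
    rwa [← hU] at this
  -- each monomial ≤ |c|·w3·U²
  have hmono : ∀ (i₁ i₂ : Fin m) (μ : Option (Fin 3)),
      |coeff i₁ i₂ i μ * lam ^ ((n : ℝ) - (if μ = some 2 then 1 else 0)) *
          X i₁ (n + ((if μ = some 0 then 1 else 0) - (if μ = some 2 then 1 else 0))) τ *
          X i₂ (n + ((if μ = some 1 then 1 else 0) - (if μ = some 2 then 1 else 0))) τ| ≤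
        |coeff i₁ i₂ i μ| * (w3 * U ^ 2) := by
    intro i₁ i₂ μ
    have ho1 : (-1 : ℤ) ≤ (if μ = some 0 then 1 else 0) - (if μ = some 2 then 1 else 0) := by
      split_ifs <;> norm_num
    have ho2 : (-1 : ℤ) ≤ (if μ = some 1 then 1 else 0) - (if μ = some 2 then 1 else 0) := by
      split_ifs <;> norm_num
    have hd : lam ^ ((n : ℝ) - (if μ = some 2 then 1 else 0)) ≤ lam ^ (n : ℝ) := by
      apply Real.rpow_le_rpow_of_exponent_le hlam.le
      split_ifs <;> norm_num
    have hx1 := hnb i₁ _ ho1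
    have hx2 := hnb i₂ _ ho2
    have hB : 0 ≤ lam ^ (-((1 / 5 : ℝ) * n)) * U := by positivity
    have hprod := mul_le_mul hx1 hx2 (abs_nonneg _) hB
    have hexp : lam ^ (n : ℝ) * lam ^ (-((1 / 5 : ℝ) * n)) * lam ^ (-((1 / 5 : ℝ) * n)) = w3 := by
      rw [hw3, ← Real.rpow_add hpos, ← Real.rpow_add hpos]
      congr 1; ring
    rw [abs_mul, abs_mul, abs_mul, abs_of_pos (Real.rpow_pos_of_pos hpos _)]
    calc |coeff i₁ i₂ i μ| * lam ^ ((n : ℝ) - (if μ = some 2 then 1 else 0)) *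
          |X i₁ (n + ((if μ = some 0 then 1 else 0) - (if μ = some 2 then 1 else 0))) τ| *
          |X i₂ (n + ((if μ = some 1 then 1 else 0) - (if μ = some 2 then 1 else 0))) τ|
        = |coeff i₁ i₂ i μ| * lam ^ ((n : ℝ) - (if μ = some 2 then 1 else 0)) *
          (|X i₁ (n + ((if μ = some 0 then 1 else 0) - (if μ = some 2 then 1 else 0))) τ| *
            |X i₂ (n + ((if μ = some 1 then 1 else 0) - (if μ = some 2 then 1 else 0))) τ|) := by ring
      _ ≤ |coeff i₁ i₂ i μ| * lam ^ (n : ℝ) *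
          ((lam ^ (-((1 / 5 : ℝ) * n)) * U) * (lam ^ (-((1 / 5 : ℝ) * n)) * U)) := by
          apply mul_le_mul (mul_le_mul_of_nonneg_left hd (abs_nonneg _)) hprod
            (mul_nonneg (abs_nonneg _) (abs_nonneg _)) (by positivity)
      _ = |coeff i₁ i₂ i μ| * (lam ^ (n : ℝ) * lam ^ (-((1 / 5 : ℝ) * n)) * lam ^ (-((1 / 5 : ℝ) * n))) *
          U ^ 2 := by ring
      _ = |coeff i₁ i₂ i μ| * (w3 * U ^ 2) := by rw [hexp]; ring
  -- linear term
  have hlin : lam ^ ((4 / 5 : ℝ) * n) * |X i n τ| ≤ w3 * U := by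
    have h0 := hnb i 0 (by norm_num)
    simp only [add_zero] at h0
    have hw : lam ^ ((4 / 5 : ℝ) * n) * lam ^ (-((1 / 5 : ℝ) * n)) = w3 := by
      rw [hw3, ← Real.rpow_add hpos]; congr 1; ring
    calc lam ^ ((4 / 5 : ℝ) * n) * |X i n τ|
        ≤ lam ^ ((4 / 5 : ℝ) * n) * (lam ^ (-((1 / 5 : ℝ) * n)) * U) :=
          mul_le_mul_of_nonneg_left h0 (Real.rpow_nonneg hpos.le _)
      _ = w3 * U := by rw [← mul_assoc, hw]
  -- assemble
  unfold rhsF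
  refine (abs_add_le _ _).trans ?_
  rw [mul_add]
  refine add_le_add ?_ ?_
  · rwa [abs_mul, abs_neg, abs_of_pos (Real.rpow_pos_of_pos hpos _)]
  · have hsum : ∑ i₁ : Fin m, ∑ i₂ : Fin m, ∑ μ : Option (Fin 3),
        |coeff i₁ i₂ i μ * lam ^ ((n : ℝ) - (if μ = some 2 then 1 else 0)) *
          X i₁ (n + ((if μ = some 0 then 1 else 0) - (if μ = some 2 then 1 else 0))) τ *
          X i₂ (n + ((if μ = some 1 then 1 else 0) - (if μ = some 2 then 1 else 0))) τ| ≤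
        coeffSum coeff i * (w3 * U ^ 2) := by
      unfold coeffSum
      rw [Finset.sum_mul]
      refine Finset.sum_le_sum fun i₁ _ => ?_
      rw [Finset.sum_mul]
      refine Finset.sum_le_sum fun i₂ _ => ?_
      rw [Finset.sum_mul]
      exact Finset.sum_le_sum fun μ _ => hmono i₁ i₂ μ
    have habs : |∑ i₁ : Fin m, ∑ i₂ : Fin m, ∑ μ : Option (Fin 3),
        coeff i₁ i₂ i μ * lam ^ ((n : ℝ) - (if μ = some 2 then 1 else 0)) *
          X i₁ (n + ((if μ = some 0 then 1 else 0) - (if μ = some 2 then 1 else 0))) τ *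
          X i₂ (n + ((if μ = some 1 then 1 else 0) - (if μ = some 2 then 1 else 0))) τ| ≤
        ∑ i₁ : Fin m, ∑ i₂ : Fin m, ∑ μ : Option (Fin 3),
        |coeff i₁ i₂ i μ * lam ^ ((n : ℝ) - (if μ = some 2 then 1 else 0)) *
          X i₁ (n + ((if μ = some 0 then 1 else 0) - (if μ = some 2 then 1 else 0))) τ *
          X i₂ (n + ((if μ = some 1 then 1 else 0) - (if μ = some 2 then 1 else 0))) τ| := by
      refine (Finset.abs_sum_le_sum_abs _ _).trans (Finset.sum_le_sum fun i₁ _ => ?_)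
      refine (Finset.abs_sum_le_sum_abs _ _).trans (Finset.sum_le_sum fun i₂ _ => ?_)
      exact Finset.abs_sum_le_sum_abs _ _
    have hS := coeffSum_le_coeffTot coeff i
    have hwU : 0 ≤ w3 * U ^ 2 := by positivity
    calc _ ≤ coeffSum coeff i * (w3 * U ^ 2) := habs.trans hsum
      _ ≤ coeffTot coeff * (w3 * U ^ 2) := mul_le_mul_of_nonneg_right hS hwU
      _ = w3 * (coeffTot coeff * U ^ 2) := by ring


/-! ## Round 2 and the theorem -/

/-- Round-2 right-hand side in FENCE-2 form: with `α₀ = 3C lam^{1/5}`, `α₁ = lam^{1/5}·4K_tot·lam^{1/5}`,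
`a = lam^{4n/5}`, `w3 = lam^{3n/5}`: `|F_{i,n}(x)| ≤ w3(α₀ + 2S_tot α₀²) + w3 α₁ a^{-1/4}(-x)^{-1/4}
+ w3(2 S_tot α₁²) a^{-1/2} (-x)^{-1/2}` for every `x < 0`. -/
theorem abs_rhsF_fence_form {lam : ℝ} (hlam : 1 < lam) (coeff : Fin m → Fin m → Fin m → Option (Fin 3) → ℝ)
    {X : Fin m → ℤ → ℝ → ℝ} (hode : SolvesODE lam coeff X) {C : ℝ}
    (hTI : ∀ (i : Fin m) (n : ℤ) (t : ℝ), t < 0 → lam ^ ((3 / 5 : ℝ) * n) * |X i n t| ≤ C / Real.sqrt (-t))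
    (i : Fin m) (n : ℤ) (x : ℝ) (hx : x < 0) :
    |rhsF lam coeff X i n x| ≤
      lam ^ ((3 / 5 : ℝ) * n) * (3 * C * lam ^ (1 / 5 : ℝ) + 2 * coeffTot coeff * (3 * C * lam ^ (1 / 5 : ℝ)) ^ 2) +
      lam ^ ((3 / 5 : ℝ) * n) * (lam ^ (1 / 5 : ℝ) * (4 * (coeffTot coeff * C ^ 2 * lam ^ (1 / 5 : ℝ)) *
        lam ^ (1 / 5 : ℝ))) * (lam ^ ((4 / 5 : ℝ) * n)) ^ (-(1 / 4 : ℝ)) * (-x) ^ (-(1 / 4 : ℝ)) +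
      lam ^ ((3 / 5 : ℝ) * n) * (2 * coeffTot coeff * (lam ^ (1 / 5 : ℝ) *
        (4 * (coeffTot coeff * C ^ 2 * lam ^ (1 / 5 : ℝ)) * lam ^ (1 / 5 : ℝ))) ^ 2) *
        (lam ^ ((4 / 5 : ℝ) * n)) ^ (-(1 / 2 : ℝ)) * (-x) ^ (-(1 / 2 : ℝ)) := by
  have hpos : 0 < lam := by linarith
  have hnx : 0 < -x := by linarith
  have h0 := abs_rhsF_le_two hlam coeff hode hTI i n x hx
  -- abbreviations
  obtain ⟨a, ha, hapos⟩ : ∃ a : ℝ, a = lam ^ ((4 / 5 : ℝ) * n) ∧ 0 < a := ⟨_, rfl, Real.rpow_pos_of_pos hpos _⟩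
  obtain ⟨w3, hw3, hw3pos⟩ : ∃ w3 : ℝ, w3 = lam ^ ((3 / 5 : ℝ) * n) ∧ 0 < w3 :=
    ⟨_, rfl, Real.rpow_pos_of_pos hpos _⟩
  obtain ⟨St, hSt, hStnn⟩ : ∃ St : ℝ, St = coeffTot coeff ∧ 0 ≤ St := ⟨_, rfl, coeffTot_nonneg coeff⟩
  obtain ⟨Kt, hKt⟩ : ∃ Kt : ℝ, Kt = coeffTot coeff * C ^ 2 * lam ^ (1 / 5 : ℝ) := ⟨_, rfl⟩
  obtain ⟨α₀, hα₀⟩ : ∃ α₀ : ℝ, α₀ = 3 * C * lam ^ (1 / 5 : ℝ) := ⟨_, rfl⟩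
  obtain ⟨α₁, hα₁⟩ : ∃ α₁ : ℝ, α₁ = lam ^ (1 / 5 : ℝ) * (4 * Kt * lam ^ (1 / 5 : ℝ)) := ⟨_, rfl⟩
  rw [← ha, ← hw3, ← hKt, ← hSt] at h0
  rw [← ha, ← hw3, ← hKt, ← hSt, ← hα₀, ← hα₁]
  -- the two negative powers of s = a(-x)
  obtain ⟨q, hq, hqnn⟩ : ∃ q : ℝ, q = (a * -x) ^ (-(1 / 4 : ℝ)) ∧ 0 ≤ q :=
    ⟨_, rfl, Real.rpow_nonneg (by positivity) _⟩
  have hq2 : q * q = (a * -x) ^ (-(1 / 2 : ℝ)) := by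
    rw [hq, ← Real.rpow_add (by positivity)]; congr 1; norm_num
  have hq4 : q = a ^ (-(1 / 4 : ℝ)) * (-x) ^ (-(1 / 4 : ℝ)) := by
    rw [hq, Real.mul_rpow hapos.le hnx.le]
  have hqq : (a * -x) ^ (-(1 / 2 : ℝ)) = a ^ (-(1 / 2 : ℝ)) * (-x) ^ (-(1 / 2 : ℝ)) :=
    Real.mul_rpow hapos.le hnx.le
  rw [← hq] at h0
  have hU : lam ^ (1 / 5 : ℝ) * (3 * C + 4 * Kt * lam ^ (1 / 5 : ℝ) * q) = α₀ + α₁ * q := by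
    rw [hα₀, hα₁]; ring
  rw [hU] at h0
  have hsq : (α₀ + α₁ * q) ^ 2 ≤ 2 * α₀ ^ 2 + 2 * α₁ ^ 2 * (q * q) := by
    nlinarith [sq_nonneg (α₀ - α₁ * q)]
  have h1 : w3 * ((α₀ + α₁ * q) + St * (α₀ + α₁ * q) ^ 2) ≤
      w3 * ((α₀ + α₁ * q) + St * (2 * α₀ ^ 2 + 2 * α₁ ^ 2 * (q * q))) := by
    apply mul_le_mul_of_nonneg_left _ hw3pos.le
    have := mul_le_mul_of_nonneg_left hsq hStnn
    linarith
  refine (h0.trans h1).trans (le_of_eq ?_)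
  rw [hq2, hqq, hq4]
  ring

/-- **TYPE I SELF-IMPROVES TO CRITICAL BOUNDEDNESS.** For every solution of a viscous Tao circuit on `(-∞,0)`
(`SolvesODE`) with the Type-I bound (`IsTypeI`), the scale-critical amplitudes are uniformly bounded:
`∃ C', ∀ i n t, t < 0 → lam^{n/5}|X_{i,n}(t)| ≤ C'`. (Work file `Cruxes/CircuitPump/Disproof.lean` §(e1); the
constant is explicit in `C`, `lam` and `S_tot = Σ|coeff|`.) Consequently every crux witness has finite residues
`X_{i,n}(0⁻)` and a frozen `1/|x|`-type trail; no DSS is used. -/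
theorem typeI_critical_bound {lam : ℝ} (hlam : 1 < lam)
    (coeff : Fin m → Fin m → Fin m → Option (Fin 3) → ℝ) (X : Fin m → ℤ → ℝ → ℝ)
    (hode : SolvesODE lam coeff X) (hTI : IsTypeI lam X) :
    ∃ C' : ℝ, ∀ (i : Fin m) (n : ℤ) (t : ℝ), t < 0 → lam ^ ((1 / 5 : ℝ) * n) * |X i n t| ≤ C' := by
  obtain ⟨C, hC⟩ := hTI
  have hpos : 0 < lam := by linarith
  obtain ⟨St, hSt, hStnn⟩ : ∃ St : ℝ, St = coeffTot coeff ∧ 0 ≤ St := ⟨_, rfl, coeffTot_nonneg coeff⟩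
  obtain ⟨α₀, hα₀⟩ : ∃ α₀ : ℝ, α₀ = 3 * C * lam ^ (1 / 5 : ℝ) := ⟨_, rfl⟩
  obtain ⟨α₁, hα₁⟩ : ∃ α₁ : ℝ, α₁ = lam ^ (1 / 5 : ℝ) * (4 * (coeffTot coeff * C ^ 2 * lam ^ (1 / 5 : ℝ)) *
      lam ^ (1 / 5 : ℝ)) := ⟨_, rfl⟩
  -- the final constant
  obtain ⟨R, hR⟩ : ∃ R : ℝ, R = (α₀ + 2 * St * α₀ ^ 2) + 4 / 3 * α₁ + 2 * (2 * St * α₁ ^ 2) := ⟨_, rfl⟩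
  refine ⟨C + R, fun i n t ht => ?_⟩
  have hnt : 0 < -t := by linarith
  have hCnn : 0 ≤ C := typeI_const_nonneg hlam hC i
  have hα₀nn : 0 ≤ α₀ := by rw [hα₀]; positivity
  have hα₁nn : 0 ≤ α₁ := by rw [hα₁]; have := coeffTot_nonneg coeff; positivity
  have hRnn : 0 ≤ R := by rw [hR]; positivity
  -- powers of lam at scale n
  obtain ⟨a, ha, hapos⟩ : ∃ a : ℝ, a = lam ^ ((4 / 5 : ℝ) * n) ∧ 0 < a := ⟨_, rfl, Real.rpow_pos_of_pos hpos _⟩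
  obtain ⟨w, hw, hwpos⟩ : ∃ w : ℝ, w = lam ^ ((1 / 5 : ℝ) * n) ∧ 0 < w := ⟨_, rfl, Real.rpow_pos_of_pos hpos _⟩
  obtain ⟨w3, hw3, hw3pos⟩ : ∃ w3 : ℝ, w3 = lam ^ ((3 / 5 : ℝ) * n) ∧ 0 < w3 :=
    ⟨_, rfl, Real.rpow_pos_of_pos hpos _⟩
  rw [← hw]
  have e_w_w3 : w = lam ^ (-((2 / 5 : ℝ) * n)) * w3 := by
    rw [hw, hw3, ← Real.rpow_add hpos]; congr 1; ring
  have e_ww3 : w * w3 = a := by rw [hw, hw3, ha, ← Real.rpow_add hpos]; congr 1; ring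
  have e_ainv : a⁻¹ = lam ^ (-((4 / 5 : ℝ) * n)) := by rw [ha, Real.rpow_neg hpos.le]
  have e_sqrt_ainv : Real.sqrt a⁻¹ = lam ^ (-((2 / 5 : ℝ) * n)) := by
    rw [e_ainv, Real.sqrt_eq_rpow, ← Real.rpow_mul hpos.le]; congr 1; ring
  have e_w3_w : lam ^ (-((3 / 5 : ℝ) * n)) * w = lam ^ (-((2 / 5 : ℝ) * n)) := by
    rw [hw, ← Real.rpow_add hpos]; congr 1; ring
  -- Type I at any time gives w|X| ≤ C·(lam^{-2n/5}/√(-τ))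
  have hTIw : ∀ τ : ℝ, τ < 0 → w * |X i n τ| ≤ C * (lam ^ (-((2 / 5 : ℝ) * n)) / Real.sqrt (-τ)) := by
    intro τ hτ
    calc w * |X i n τ| = lam ^ (-((2 / 5 : ℝ) * n)) * (w3 * |X i n τ|) := by rw [e_w_w3]; ring
      _ ≤ lam ^ (-((2 / 5 : ℝ) * n)) * (C / Real.sqrt (-τ)) := by
          rw [hw3]; exact mul_le_mul_of_nonneg_left (hC i n τ hτ) (Real.rpow_nonneg hpos.le _)
      _ = C * (lam ^ (-((2 / 5 : ℝ) * n)) / Real.sqrt (-τ)) := by ring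
  by_cases hs : a * (-t) ≤ 1
  · -- FENCE 2 from t₀ = -a⁻¹
    obtain ⟨t₀, ht₀def⟩ : ∃ t₀ : ℝ, t₀ = -a⁻¹ := ⟨_, rfl⟩
    have hnt₀ : -t₀ = a⁻¹ := by rw [ht₀def, neg_neg]
    have ht₀neg : t₀ < 0 := by rw [ht₀def]; exact neg_neg_of_pos (inv_pos.2 hapos)
    have ht₀t : t₀ ≤ t := by
      rw [ht₀def, neg_le]
      calc -t = a⁻¹ * (a * -t) := by field_simp
        _ ≤ a⁻¹ * 1 := mul_le_mul_of_nonneg_left hs (inv_nonneg.2 hapos.le)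
        _ = a⁻¹ := mul_one _
    have hf : ∀ x ∈ Icc t₀ t, HasDerivAt (X i n) (rhsF lam coeff X i n x) x :=
      fun x hx => hode i n x (lt_of_le_of_lt hx.2 ht)
    have hb : ∀ x ∈ Ico t₀ t, |rhsF lam coeff X i n x| ≤
        w3 * (α₀ + 2 * St * α₀ ^ 2) + w3 * α₁ * a ^ (-(1 / 4 : ℝ)) * (-x) ^ (-(1 / 4 : ℝ)) +
          w3 * (2 * St * α₁ ^ 2) * a ^ (-(1 / 2 : ℝ)) * (-x) ^ (-(1 / 2 : ℝ)) := by
      intro x hx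
      have h := abs_rhsF_fence_form hlam coeff hode hC i n x (lt_trans hx.2 ht)
      rw [← ha, ← hw3, ← hα₁, ← hα₀, ← hSt] at h
      exact h
    have key := fence_two ht₀t ht hf hb
    -- drop the favourable terms and use t - t₀ ≤ a⁻¹
    have hR₀ : 0 ≤ w3 * (α₀ + 2 * St * α₀ ^ 2) := by positivity
    have hR₁ : 0 ≤ w3 * α₁ * a ^ (-(1 / 4 : ℝ)) := by
      have := Real.rpow_nonneg hapos.le (-(1 / 4 : ℝ)); positivity
    have hR₂ : 0 ≤ w3 * (2 * St * α₁ ^ 2) * a ^ (-(1 / 2 : ℝ)) := by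
      have := Real.rpow_nonneg hapos.le (-(1 / 2 : ℝ)); positivity
    have hdt : t - t₀ ≤ a⁻¹ := by rw [ht₀def]; linarith
    have p0 := mul_le_mul_of_nonneg_left hdt hR₀
    have p1 := mul_nonneg hR₁ (Real.rpow_nonneg hnt.le (3 / 4 : ℝ))
    have p2 := mul_nonneg hR₂ (Real.rpow_nonneg hnt.le (1 / 2 : ℝ))
    have hdrop : |X i n t| ≤ |X i n t₀| + w3 * (α₀ + 2 * St * α₀ ^ 2) * a⁻¹ +
        4 / 3 * (w3 * α₁ * a ^ (-(1 / 4 : ℝ))) * (-t₀) ^ (3 / 4 : ℝ) +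
        2 * (w3 * (2 * St * α₁ ^ 2) * a ^ (-(1 / 2 : ℝ))) * (-t₀) ^ (1 / 2 : ℝ) := by
      linarith
    rw [hnt₀] at hdrop
    -- multiply by w
    have e_q : a ^ (-(1 / 4 : ℝ)) * a⁻¹ ^ (3 / 4 : ℝ) = a⁻¹ := by
      rw [Real.inv_rpow hapos.le, ← Real.rpow_neg hapos.le, ← Real.rpow_add hapos, ← Real.rpow_neg_one]
      congr 1; norm_num
    have e_h : a ^ (-(1 / 2 : ℝ)) * a⁻¹ ^ (1 / 2 : ℝ) = a⁻¹ := by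
      rw [Real.inv_rpow hapos.le, ← Real.rpow_neg hapos.le, ← Real.rpow_add hapos, ← Real.rpow_neg_one]
      congr 1; norm_num
    have step1 : w * |X i n t₀| ≤ C := by
      have h := hTIw t₀ ht₀neg
      rw [hnt₀, e_sqrt_ainv, div_self (Real.rpow_pos_of_pos hpos _).ne', mul_one] at h
      exact h
    have step2 : w * (w3 * (α₀ + 2 * St * α₀ ^ 2) * a⁻¹ +
        4 / 3 * (w3 * α₁ * a ^ (-(1 / 4 : ℝ))) * a⁻¹ ^ (3 / 4 : ℝ) +
        2 * (w3 * (2 * St * α₁ ^ 2) * a ^ (-(1 / 2 : ℝ))) * a⁻¹ ^ (1 / 2 : ℝ)) = R := by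
      have ha1 : a * a⁻¹ = 1 := mul_inv_cancel₀ hapos.ne'
      calc _ = (w * w3) * a⁻¹ * (α₀ + 2 * St * α₀ ^ 2) +
            4 / 3 * α₁ * (w * w3) * (a ^ (-(1 / 4 : ℝ)) * a⁻¹ ^ (3 / 4 : ℝ)) +
            2 * (2 * St * α₁ ^ 2) * (w * w3) * (a ^ (-(1 / 2 : ℝ)) * a⁻¹ ^ (1 / 2 : ℝ)) := by ring
        _ = (a * a⁻¹) * ((α₀ + 2 * St * α₀ ^ 2) + 4 / 3 * α₁ + 2 * (2 * St * α₁ ^ 2)) := by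
            rw [e_ww3, e_q, e_h]; ring
        _ = R := by rw [ha1, one_mul, hR]
    have hmul := mul_le_mul_of_nonneg_left hdrop hwpos.le
    rw [mul_add, mul_add, mul_add] at hmul
    have : w * |X i n t| ≤ w * |X i n t₀| + R := by
      rw [← step2]; linarith
    linarith
  · -- s ≥ 1: Type I alone
    have hs : 1 < a * -t := not_le.1 hs
    have hle : lam ^ (-((2 / 5 : ℝ) * n)) / Real.sqrt (-t) ≤ 1 := by
      rw [div_le_one (Real.sqrt_pos.2 hnt)]
      apply Real.le_sqrt_of_sq_le
      have : (lam ^ (-((2 / 5 : ℝ) * n))) ^ 2 = a⁻¹ := by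
        rw [e_ainv, sq, ← Real.rpow_add hpos]; congr 1; ring
      rw [this]
      calc a⁻¹ = a⁻¹ * 1 := (mul_one _).symm
        _ ≤ a⁻¹ * (a * -t) := mul_le_mul_of_nonneg_left hs.le (inv_nonneg.2 hapos.le)
        _ = -t := by field_simp
    have h := hTIw t ht
    have : C * (lam ^ (-((2 / 5 : ℝ) * n)) / Real.sqrt (-t)) ≤ C * 1 := mul_le_mul_of_nonneg_left hle hCnn
    linarith

end Summit.NavierStokesRegularity.NavierStokesRegularity.Theorems.CircuitPumpNegative
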